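import Mathlib
import Literature.Claims.NS.ClayVariants
import Literature.Analysis.FluidPDE.ClassicalSolution
import Literature.Analysis.FluidPDE.TaoAveragedQuaternionRotation
import Literature.Analysis.FluidPDE.NSStrongSpeedBound
import Literature.Analysis.FluidPDE.NSFourierSplittingControl
import Literature.Analysis.FluidPDE.NSEnstrophyPersistence
import Literature.Analysis.FluidPDE.WholeSpaceIBP
import Literature.Analysis.FluidPDE.TaoEnstrophyLocalisationProofs
import Literature.Analysis.FluidPDE.EnergyUniqueness
import Literature.Analysis.FluidPDE.EnergyToolkit
import HarnessLib

/-!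
# CLAIM C37 — F. A. Chishtie, «A unified quaternion-complex framework for Navier-Stokes equations:
# new insights and implications» (arXiv:2505.22853 [physics.flu-dyn], cross-list math.CV)

VERSION TYPED: **v3 (2025-06-08, 43 pp.)** (v1 2025-05-28, 15 pp., already carries the Clay section as
«Theorem 1» with the same four Steps; v2 2025-06-02; no withdrawal, no journal-ref; listing read
2026-08-27). Sources: `run/shared/lean/pub/ns-claims/sources/Chishtie2025/` (PDF/TeX v1+v3, per-page
text `text-2505.22853v3/pNNN.txt`, PDF page = print page; LOCATORS.md by ns-claims-lit-1). Equation
numbers below are the printed ones of v3; «l.N» = TeX line of `2505.22853v3_NS_CQ_framework_v3.tex`.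
Bib key `Chishtie2025QuaternionNS`. UNREFEREED CLAIM under adjudication (cell ns-claims, D-0090):
NOTHING in this file asserts a step of the paper — every printed assertion is a `def … : Prop`; the
`theorem`s are kernel-checked relations between them (and two classical identities, proved).

WHAT THIS IS NOT: not a claim about NS regularity or blow-up; not a claim about any author beyond the
typed locator.

## Claimed statements (as printed)

* Abstract (p.1): «We prove that for any smooth initial data, there exists a unique global smooth
  solution to the three-dimensional incompressible Navier-Stokes equations, directly resolving the Clay
  Institute challenge.»
* **Theorem 5.5** [Global regularity of quaternion Navier-Stokes] (p.13, l.460–468): «For any initial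
  data `Q₀ ∈ H^s(ℝ³; Im(ℍ))` with `s ≥ 3` and `∇·Re(Q₀) = 0`, there exists a unique global smooth
  solution `Q ∈ C^∞([0,∞) × ℝ³; Im(ℍ))` to the quaternion Navier-Stokes system
  (76) `∂Q/∂t + Q ⋆ ∇_Q Q + Q̄ ⋆ ∇_Q̄ Q = −(1/ρ)∇_Q p + ν∇²Q`, (77) `∇·Re(Q) = 0`.»
* **Corollary 5.6** [Clay Institute Resolution] (p.17, l.649–657): «For the classical three-dimensional
  incompressible Navier-Stokes equations in `ℝ³`: (118) `∂u/∂t + (u·∇)u = −(1/ρ)∇p + νΔu`,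
  (119) `∇·u = 0`, with smooth initial data `u₀ ∈ H^s(ℝ³)` for `s ≥ 3`, there exists a unique global
  smooth solution `u ∈ C^∞([0,∞) × ℝ³)`.» Proof (l.659–661): «The isomorphism `u ↔ Re(Q)` … preserves
  Sobolev norms … incompressibility … the nonlinear structure `(u·∇)u ↔ Re(Q ⋆ ∇_Q Q + Q̄ ⋆ ∇_Q̄ Q)`.
  The quaternion global regularity therefore transfers directly to the classical Navier-Stokes system.»

Conventions (p.7 (17)–(19); p.11–12 (66)–(70)): `Q = u i + v j + w k` (the velocity as a purely
imaginary quaternion field — here `Qf u x = quatOf (u x)` with the tree's `Tao2016.quatOf`), `⋆` the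
quaternion product, `∇_Q = i∂_x + j∂_y + k∂_z`, `∇_Q̄ = i∂_x − j∂_y − k∂_z` (acting on a quaternion
field by LEFT multiplication of the units with the partial derivatives — `nablaQ`, `nablaQbar`),
`Q̄` the conjugate (`star`), `|q|` the quaternion norm. `∇·Re(Q) = 0` in (77) is read as the
incompressibility (22) p.7 «`∇·u = Re(∇_Q · Q) = 0`», i.e. `div u = 0` (the literal «real part of a
purely imaginary field» is identically `0` and would make (77) empty — TYPING-HYGIENE §6). Data
«`Q₀ ∈ H^s`, `s ≥ 3`» with a conclusion smooth up to `t = 0` is typed for SMOOTH `H^s` data (as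
Corollary 5.6 itself says «smooth initial data `u₀ ∈ H^s`»); uniqueness clauses are not typed (weaker).

## Architecture of the printed argument and ORDERED STEP INDEX (dependency order, ties by print order)

The headline (Cor 5.6) ⇐ Thm 5.5 + the transfer `u ↔ Q` whose content is the convection
decomposition (20) p.7; Thm 5.5 ⇐ four Steps (p.13–16). The «quaternion Navier–Stokes system»
(21)–(22) = (76)–(77) is introduced on p.7 as «the complete three-dimensional system» BY (20), so (20)
is the first display the argument uses (it is what makes §5 a statement about Navier–Stokes at all);
in the kernel composition it is consumed at the transfer (`cor56_of_thm55`, PROVED from Step 1).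

* Step 1  = `Step1_Convection20`        — (20) p.7, §4.2 l.192–200: `(u·∇)Q = Q ⋆ ∇_Q Q + Q̄ ⋆ ∇_Q̄ Q`
            («the key breakthrough extends to three dimensions»; stated, no derivation; the 2-D
            analogue (11) p.5 IS derived). Pointwise identity for smooth divergence-free `u`.
* Step 2  = `Step2_Lemma51`             — Lemma 5.1 (71) p.12: `Re(a ⋆ b) = −a·b` on `Im ℍ`. PROVED (`step2_holds`).
* Step 3  = `Step3a_Orthogonality83` / `Step3b_Orthogonality84` — proof of Thm 5.5, Step 1, (79)–(84)
            p.13–14: `Re⟨Q ⋆ ∇_Q Q, Q⟩_{L²} = 0` and «Similarly for the `Q̄ ⋆ ∇_Q̄ Q` term».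
* Step 4  = `Step4_EnergyEquality86`    — (85)–(86) p.14: `‖Q(t)‖² + 2ν∫₀ᵗ‖∇Q‖² = ‖Q₀‖²` for solutions of (76)–(77).
* Step 5  = `Step5_Lemma52`             — Lemma 5.2 (72) p.12 = (88) p.14 «quaternion energy constraint»:
            `|Q ⋆ ∇_Q Q|² + |Q̄ ⋆ ∇_Q̄ Q|² = |Q|²|∇Q|²` pointwise, «for any quaternion field `Q : ℝ³ → Im(ℍ)`».
* Step 6  = `Step6_ConjugateBound89`    — (89) p.14: `‖∇_Q̄ Q‖²_{L²} ≤ C‖∇_Q Q‖_{L²}^{1/2}‖Q‖_{H¹}^{3/2}`.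
* Step 7  = `Step7_Lemma53`             — Lemma 5.3 p.12 (Leibniz rule for `∇_Q^s` of a `⋆`-product), used at (98)–(100) p.15.
* Step 8  = `Step8_Lemma54`             — Lemma 5.4 (75) p.13, `‖f‖_{L^∞} ≤ C‖f‖_{H^s}` (`s > 3/2`), used at (103) p.15.
* Step 9  = `Step9_Ineq107_abs`         — p.15: the passage (97) ∧ (100) ∧ (103) ∧ (104) ∧ (105) ∧ (106) ⇒ (107)
            at the grain of the displayed inequalities between the real numbers `‖∇_Q^s Q‖_{L²}`,
            `‖∇_Q^{s+1} Q‖_{L²}`, `‖Q‖_{H^s}` (TYPING-HYGIENE 13): the bound that (100)·(103) give for the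
            nonlinear pairing carries the factor `‖∇_Q^s Q‖_{L²}` of (100); (106)–(107) treat it without it.
* Step 10 = `Step10_Ineq107`            — (107) p.15 at the solution grain: for every `H^s` solution of
            (76)–(77), `d/dt‖∇_Q^sQ‖² + (ν/2)‖∇_Q^{s+1}Q‖² ≤ C‖Q‖²_{H^s}`, `C = C(ν,s)` (integrated form).
* Step 11 = `Step11_Gronwall109`        — (108)–(109) p.15: Step 10 ∧ Step 4 ⇒ `X(t) ≤ X(0)e^{Ct}`, `X = ‖Q‖²_{H^s}`.
* Step 12 = `Step12_Ineq112_abs`        — p.16 (111)–(113): «from the fundamental energy balance (85) …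
            `‖∇Q(t)‖²_{L²} ≤ ‖∇Q(0)‖²_{L²}`» at the grain of the real functions `t ↦ ‖Q(t)‖²`, `t ↦ ‖∇Q(t)‖²`.
* Step 13 = `Step13_Ineq113`            — (113) p.16 at the solution grain: `‖∇Q(t)‖² ≤ C‖Q₀‖²_{H¹}` uniformly in `t`.
* Step 14 = `Step14_H1toHs`             — p.16 l.636: «This contradiction establishes `sup_{[0,T*)}‖Q(t)‖_{H^s} < ∞`»
            (Step 13 ⇒ the a-priori `H^s` bound; the Step-4 route).
* Step 15 = `Step15_Continuation`       — p.16 l.636–639: «by standard continuation theory, the solution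
            extends beyond `T*` … global existence follows» + «Smoothness»: a-priori `H^s` bound ⇒ Thm 5.5
            (no local well-posedness theory for the system (76)–(77) is cited).
* Transfer = `cor56_of_thm55`           — Cor 5.6 proof p.17: Step 1 ∧ Theorem 5.5 ⇒ Corollary 5.6. PROVED.

COMPOSITION: PROVED as `claim_of_steps` (Step-3 route of the paper: Step 10 → Step 11 (with Step 4) →
(109) → Step 15 ⇒ Thm 5.5; Step 1 + Thm 5.5 ⇒ Cor 5.6 by `cor56_of_thm55`; Steps 2, 3, 5–9, 12–14 are
displayed inputs of the printed proofs and carry `_` binders) and as `claim_of_steps_via_step4` (the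
paper's Step-4 route: Step 13 → Step 14 → Step 15). Both routes are printed (p.15 «However, this bound
depends on the constant `C`, which we will show is controlled by the quaternion constraints» hands from
(109) to Step 4; (109) alone already bounds `sup_{[0,T*)}‖Q‖_{H^s}` for finite `T*`).

## Clay delta (reference `Literature/Claims/NS/ClayVariants.lean`)

Nearest: (A). Cor 5.6 is (A)-shaped and typed over the schema as `chishtieSpec.Regularity`
(`ℝ³`, `f ≡ 0`, `∀ ν > 0`; the paper's constant density `ρ` is fixed to `1` there — a specialisation,
weaker than printed; Thm 5.5 keeps `ρ > 0`). Δ4 DATA CLASS: `u₀` smooth, divergence-free, in `H^s`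
for some `s ≥ 3` ⊋ Clay's (4) — the good direction (`hsData_of_hasRapidSpatialDecay`, PROVED). Δ6 FORM OF
THE CONCLUSION: the printed conclusion is a global smooth solution with NO side condition — Clay's
bounded energy (7) is not printed ⇒ `clay_of_claimed` is NOT provable; `ClayDelta` := the upgrade of the
printed conclusion to one with (7); `clay_of_claimed_of_delta` PROVED by `RegularityAt.mono`. Δ2
EQUATIONS: Theorem 5.5 concerns the system (76)–(77), which is Navier–Stokes exactly insofar as (20)
(Step 1) is an identity — recorded at Step 1 / the transfer, not as a statement-level delta of Cor 5.6
(Cor 5.6 is printed for (118)–(119) = classical NS).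
-/

open Set Function MeasureTheory Filter Topology
open scoped ContDiff ENNReal NNReal Laplacian Quaternion

namespace Literature.Claims.NS.Chishtie2025

open Literature.Analysis.FluidPDE Literature.Analysis.FluidPDE.Tao2016

noncomputable section

/-! ## Vocabulary (concrete; conventions (17)–(19) p.7, (66)–(70) p.11–12) -/

/-- `ℝ³`. [cite: Chishtie2025QuaternionNS, §4.1 (17) p.7] -/
abbrev E3 : Type := EuclideanSpace ℝ (Fin 3)

/-- Coordinate vector `e_j`. [cite: Chishtie2025QuaternionNS, (19) p.7] -/
def e (j : Fin 3) : E3 := EuclideanSpace.single j (1 : ℝ)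

/-- The quaternion unit `i`. [cite: Chishtie2025QuaternionNS, (18) p.7, (66) p.11] -/
def qi : ℍ := ⟨0, 1, 0, 0⟩
/-- The quaternion unit `j`. [cite: Chishtie2025QuaternionNS, (18) p.7, (66) p.11] -/
def qj : ℍ := ⟨0, 0, 1, 0⟩
/-- The quaternion unit `k`. [cite: Chishtie2025QuaternionNS, (18) p.7, (66) p.11] -/
def qk : ℍ := ⟨0, 0, 0, 1⟩

/-- The quaternion velocity field `Q = u i + v j + w k` of a vector field `u` ((17) p.7): the purely
imaginary quaternion field `x ↦ quatOf (u x)` (tree embedding `Tao2016.quatOf`).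
[cite: Chishtie2025QuaternionNS, (17) p.7] -/
def Qf (u : E3 → E3) : E3 → ℍ := fun x => quatOf (u x)

/-- `quatOf` as a continuous linear map `ℝ³ →L[ℝ] ℍ` (for chain-rule computations with `Qf`).
[cite: Chishtie2025QuaternionNS, (17) p.7] -/
def quatOfL : E3 →L[ℝ] ℍ :=
  LinearMap.toContinuousLinearMap
    { toFun := quatOf
      map_add' := quatOf_add
      map_smul' := fun c v => by simp [quatOf_smul] }

/-- `quatOfL v = quatOf v`. [cite: Chishtie2025QuaternionNS, (17) p.7] -/
@[simp] theorem quatOfL_apply (v : E3) : quatOfL v = quatOf v := rfl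

/-- Chain rule for `Q = quatOf ∘ u`: `DQ(x) = quatOf ∘ Du(x)`. [cite: Chishtie2025QuaternionNS, (17) p.7] -/
theorem hasFDerivAt_Qf {u : E3 → E3} {L : E3 →L[ℝ] E3} {x : E3} (h : HasFDerivAt u L x) :
    HasFDerivAt (Qf u) (quatOfL.comp L) x :=
  quatOfL.hasFDerivAt.comp x h

/-- Partial derivative `∂_j F (x)` of a quaternion field (`j = 0,1,2` ↔ `x,y,z`); junk `0` where `F` is not
differentiable (only smooth fields are quantified below). [cite: Chishtie2025QuaternionNS, (19) p.7] -/
def pd (j : Fin 3) (F : E3 → ℍ) (x : E3) : ℍ := fderiv ℝ F x (e j)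

/-- `∂_j (quatOf ∘ u)(x) = quatOf (Du(x) e_j)`. [cite: Chishtie2025QuaternionNS, (19) p.7] -/
theorem pd_Qf {u : E3 → E3} {L : E3 →L[ℝ] E3} {x : E3} (h : HasFDerivAt u L x) (j : Fin 3) :
    pd j (Qf u) x = quatOf (L (e j)) := by
  rw [pd, (hasFDerivAt_Qf h).fderiv]
  rfl

/-- **`∇_Q F = i ⋆ ∂_x F + j ⋆ ∂_y F + k ⋆ ∂_z F`** ((19) p.7, (69) p.12; units multiply on the LEFT).
[cite: Chishtie2025QuaternionNS, (19) p.7, (69) p.12] -/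
def nablaQ (F : E3 → ℍ) (x : E3) : ℍ := qi * pd 0 F x + qj * pd 1 F x + qk * pd 2 F x

/-- **`∇_Q̄ F = i ⋆ ∂_x F − j ⋆ ∂_y F − k ⋆ ∂_z F`** ((70) p.12). [cite: Chishtie2025QuaternionNS, (70) p.12] -/
def nablaQbar (F : E3 → ℍ) (x : E3) : ℍ := qi * pd 0 F x - qj * pd 1 F x - qk * pd 2 F x

/-- The `m`-fold quaternion gradient `∇_Q^m F` (used from (97) on, p.15). [cite: Chishtie2025QuaternionNS, (97) p.15] -/
def nablaQPow (m : ℕ) (F : E3 → ℍ) : E3 → ℍ := (nablaQ)^[m] F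

/-- `|∇F|²(x) = Σ_j |∂_j F(x)|²` (the pointwise gradient energy in (72), (85)). [cite: Chishtie2025QuaternionNS, (72) p.12] -/
def gradNormSq (F : E3 → ℍ) (x : E3) : ℝ := ∑ j : Fin 3, ‖pd j F x‖ ^ 2

/-- **The quaternion nonlinearity `Q ⋆ ∇_Q Q + Q̄ ⋆ ∇_Q̄ Q`** of (20)/(21)/(76) for `Q = Qf u`.
[cite: Chishtie2025QuaternionNS, (20) p.7, (76) p.13] -/
def qnonlin (u : E3 → E3) (x : E3) : ℍ :=
  Qf u x * nablaQ (Qf u) x + star (Qf u x) * nablaQbar (Qf u) x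

/-- `‖F‖²_{L²} = ∫ |F|²` (Bochner; the Steps below quantify over classes where the integrand is integrable,
TYPING-HYGIENE §2). [cite: Chishtie2025QuaternionNS, (78) p.13] -/
def l2sq (F : E3 → ℍ) : ℝ := ∫ x, ‖F x‖ ^ 2

/-- `‖∇_Q^m Q‖²_{L²}` for `Q = Qf u`. [cite: Chishtie2025QuaternionNS, (97) p.15] -/
def qn (m : ℕ) (u : E3 → E3) : ℝ := l2sq (nablaQPow m (Qf u))

/-- `X = ‖Q‖²_{H^s}` rendered as `Σ_{m ≤ s} ‖∇_Q^m Q‖²_{L²}` (the paper does not define its `H^s` norm; this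
is the quantity that (107) summed over orders controls, (108) p.15). [cite: Chishtie2025QuaternionNS, (108) p.15] -/
def hsq (s : ℕ) (u : E3 → E3) : ℝ := ∑ m ∈ Finset.range (s + 1), qn m u

/-- `‖Q‖²_{H¹} = ‖Q‖²_{L²} + ‖∇Q‖²_{L²}` ((89), (113)). [cite: Chishtie2025QuaternionNS, (89) p.14] -/
def h1sq (u : E3 → E3) : ℝ := l2sq (Qf u) + ∫ x, gradNormSq (Qf u) x

/-- «`u₀ ∈ H^s(ℝ³)` for some `s ≥ 3`» (Thm 5.5 / Cor 5.6 data), ON TOP of smoothness: all derivatives of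
order `≤ s` square-integrable. [cite: Chishtie2025QuaternionNS, Thm 5.5 p.13, Cor 5.6 p.17] -/
def HsData (u₀ : E3 → E3) : Prop :=
  ∃ s : ℕ, 3 ≤ s ∧ ∀ m ≤ s, MemLp (iteratedFDeriv ℝ m u₀) 2 (volume : Measure E3)

/-- The `H^s` CLASS of a solution on `[0,T]` in which the a-priori Steps are stated («`Q ∈ H^s`»; the
dissipation term of (97)/(107) needs one more derivative): for every `t ∈ [0,T]` and `m ≤ s + 1`,
`|D^m u(t)|²` and `|∇_Q^m Q(t)|²` are integrable, and so are `|∇Q(t)|²`, `|∇_Q̄ Q(t)|²` (all the `L²`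
quantities the Steps mention are then honest integrals, TYPING-HYGIENE §2). [cite: Chishtie2025QuaternionNS, Step 3 (97) p.15] -/
def InHsClass (s : ℕ) (T : ℝ) (u : ℝ → E3 → E3) : Prop :=
  ∀ t ∈ Icc 0 T,
    (∀ m ≤ s + 1, Integrable (fun x => ‖iteratedFDeriv ℝ m (u t) x‖ ^ 2) (volume : Measure E3)) ∧
    (∀ m ≤ s + 1, Integrable (fun x => ‖nablaQPow m (Qf (u t)) x‖ ^ 2) (volume : Measure E3)) ∧
    Integrable (gradNormSq (Qf (u t))) (volume : Measure E3) ∧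
    Integrable (fun x => ‖nablaQbar (Qf (u t)) x‖ ^ 2) (volume : Measure E3)

/-- **A smooth solution of the quaternion Navier–Stokes system (76)–(77) on the time set `S`** (= (21)–(22)
p.7), for the velocity `u` (so `Q = Qf u`) and pressure `p`, viscosity `ν`, constant density `ρ`:
`u`, `p` jointly smooth on `S × ℝ³`; (76) pointwise with `∂_t`, `∇_Q p = quatOf (∇p)` and
`∇²Q = quatOf (Δu)` componentwise; (77) as `div u = 0` ((22) p.7). Mirrors the tree's
`IsClassicalNSSolutionOn`. [cite: Chishtie2025QuaternionNS, (76)–(77) p.13, (21)–(22) p.7] -/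
structure IsQNSSolutionOn (S : Set ℝ) (ν ρ : ℝ) (u : ℝ → E3 → E3) (p : ℝ → E3 → ℝ) : Prop where
  smooth_velocity : IsSmoothSpaceTimeOn S u
  smooth_pressure : IsSmoothSpaceTimeOn S p
  momentum : ∀ t ∈ S, ∀ x,
    quatOf (timeDerivWithin S u t x) + qnonlin (u t) x =
      -(1 / ρ) • quatOf (gradient (p t) x) + ν • quatOf (Δ (u t) x)
  divFree : ∀ t ∈ S, NSWave0.IsDivFree (u t)

/-! ## The claimed statements -/

/-- **Theorem 5.5** (p.13), existence part, for smooth `H^s` data: for every `ν > 0`, `ρ > 0` and every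
smooth divergence-free `u₀` with `u₀ ∈ H^s` for some `s ≥ 3` there is a global smooth solution of the
quaternion system (76)–(77) on `[0,∞) × ℝ³` with `u(0) = u₀` (uniqueness not typed — weaker).
[cite: Chishtie2025QuaternionNS, Thm 5.5 (76)–(77) p.13] [claim: Chishtie2025QuaternionNS, status: under-review] -/
def Thm55 : Prop :=
  ∀ ν ρ : ℝ, 0 < ν → 0 < ρ → ∀ u₀ : E3 → E3, ContDiff ℝ ∞ u₀ → NSWave0.IsDivFree u₀ → HsData u₀ →
    ∃ (u : ℝ → E3 → E3) (p : ℝ → E3 → ℝ), IsQNSSolutionOn (Ici 0) ν ρ u p ∧ u 0 = u₀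

/-- The spec of Corollary 5.6 in the Clay schema: data = smooth divergence-free `u₀ ∈ H^s`, `s ≥ 3`
(the schema adds `C^∞` and `div u₀ = 0`); NO side condition on the solution (none is printed); the force
slot is not read by `Regularity` (set to Clay's (5)). [cite: Chishtie2025QuaternionNS, Cor 5.6 p.17] -/
def chishtieSpec : ClayVariants.ClaySpec where
  data := HsData
  force := HasRapidSpaceTimeDecay
  admissible := fun _ _ => True

/-- **Corollary 5.6** (p.17), existence part, at density `ρ = 1`: for every `ν > 0` and every smooth
divergence-free `u₀ ∈ H^s(ℝ³)`, `s ≥ 3`, a smooth solution `(u,p)` of (118)–(119) on `ℝ³ × [0,∞)` with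
`u(0) = u₀` (tree predicates `IsSmoothOnHalfSpace`, `IsNavierStokesSolution ν 0 u₀ u p`; no energy bound,
no uniqueness). [cite: Chishtie2025QuaternionNS, Cor 5.6 (118)–(119) p.17] [claim: Chishtie2025QuaternionNS, status: under-review] -/
def Cor56 : Prop := chishtieSpec.Regularity

/-- THE CLAIMED THEOREM: Theorem 5.5 ∧ Corollary 5.6 (existence parts). A `def`, never a `theorem`.
[cite: Chishtie2025QuaternionNS, Thm 5.5 p.13, Cor 5.6 p.17] [claim: Chishtie2025QuaternionNS, status: under-review] -/
def ClaimedTheorem : Prop := Thm55 ∧ Cor56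

/-! ## Steps, in the order the printed argument uses them -/

/-- **Step 1 — the convection decomposition (20), §4.2 p.7 (l.192–200):** «The key breakthrough extends to
three dimensions through the quaternion convection term: `(u·∇)Q = Q ⋆ ∇_Q Q + Q̄ ⋆ ∇_Q̄ Q`.» Typed
pointwise for every smooth divergence-free `u` (the context is the velocity of (21)–(22)), with
`(u·∇)Q = quatOf ((u·∇)u)` componentwise. No derivation is printed (the 2-D identity (11) p.5 is
derived). This identity is what makes (21)–(22) = (76)–(77) «the complete three-dimensional system»
and is the content of the transfer in the proof of Cor 5.6 p.17 («preserves the nonlinear structure»).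
[cite: Chishtie2025QuaternionNS, (20) p.7; Cor 5.6 proof p.17] [claim: Chishtie2025QuaternionNS, status: under-review] -/
def Step1_Convection20 : Prop :=
  ∀ u : E3 → E3, ContDiff ℝ ∞ u → NSWave0.IsDivFree u → ∀ x : E3, quatOf (convect u u x) = qnonlin u x

/-- **Step 2 — Lemma 5.1 (71) p.12** [Quaternion orthogonality identity]: «For purely imaginary
quaternions `a, b ∈ Im(ℍ)`: `Re(a ⋆ b) = −a·b`.» TRUE; proved below (`step2_holds`).
[cite: Chishtie2025QuaternionNS, Lemma 5.1 (71) p.12] -/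
def Step2_Lemma51 : Prop :=
  ∀ a b : E3, (quatOf a * quatOf b).re = -(@inner ℝ E3 _ a b)

/-- Lemma 5.1 holds (tree identity `quatOf_mul_quatOf`: `a ⋆ b = −a·b + a × b`).
[cite: Chishtie2025QuaternionNS, Lemma 5.1 (71) p.12] -/
theorem step2_holds : Step2_Lemma51 := by
  intro a b
  rw [quatOf_mul_quatOf]
  simp

/-- **Step 3a — proof of Thm 5.5, Step 1, (79)–(84) p.13–14:** «`Re⟨Q ⋆ ∇_Q Q, Q⟩_{L²} = ∫ Re[(Q ⋆ ∇_Q Q) ⋆ Q̄] dx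
= … = 0`, where the last equality follows from the divergence theorem and decay at infinity» — typed for
smooth compactly supported divergence-free `u` (decay granted in the strongest form).
[cite: Chishtie2025QuaternionNS, (79)–(84) p.13–14] [claim: Chishtie2025QuaternionNS, status: under-review] -/
def Step3a_Orthogonality83 : Prop :=
  ∀ u : E3 → E3, ContDiff ℝ ∞ u → HasCompactSupport u → NSWave0.IsDivFree u →
    ∫ x, ((Qf u x * nablaQ (Qf u) x) * star (Qf u x)).re = 0

/-- **Step 3b — ibid., l.487 p.14:** «Similarly for the `Q̄ ⋆ ∇_Q̄ Q` term» — i.e.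
`∫ Re[(Q̄ ⋆ ∇_Q̄ Q) ⋆ Q̄] dx = 0`, for the same class. (With 3a this is what turns (78) into (85).)
[cite: Chishtie2025QuaternionNS, Step 1 l.487 p.14] [claim: Chishtie2025QuaternionNS, status: under-review] -/
def Step3b_Orthogonality84 : Prop :=
  ∀ u : E3 → E3, ContDiff ℝ ∞ u → HasCompactSupport u → NSWave0.IsDivFree u →
    ∫ x, ((star (Qf u x) * nablaQbar (Qf u) x) * star (Qf u x)).re = 0

/-- **Step 4 — the energy equality (85)–(86) p.14:** «`d/dt‖Q‖²_{L²} + 2ν‖∇Q‖²_{L²} = 0`. This yields the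
global energy bound `‖Q(t)‖²_{L²} + 2ν∫₀ᵗ‖∇Q(τ)‖²_{L²}dτ = ‖Q₀‖²_{L²}`» — for every smooth solution of
(76)–(77) on `[0,T]` in the `H^s` class (`s ≥ 3`, so all integrands are integrable).
[cite: Chishtie2025QuaternionNS, (85)–(86) p.14] [claim: Chishtie2025QuaternionNS, status: under-review] -/
def Step4_EnergyEquality86 : Prop :=
  ∀ (ν ρ T : ℝ) (s : ℕ) (u : ℝ → E3 → E3) (p : ℝ → E3 → ℝ), 0 < ν → 0 < ρ → 0 < T → 3 ≤ s →
    IsQNSSolutionOn (Icc 0 T) ν ρ u p → InHsClass s T u →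
      ∀ t ∈ Icc 0 T,
        l2sq (Qf (u t)) + 2 * ν * ∫ τ in (0 : ℝ)..t, (∫ x, gradNormSq (Qf (u τ)) x) = l2sq (Qf (u 0))

/-- **Step 5 — Lemma 5.2 (72) p.12 = (88) p.14** [Quaternion energy constraint]: «For any quaternion field
`Q : ℝ³ → Im(ℍ)`: `|Q ⋆ ∇_Q Q|² + |Q̄ ⋆ ∇_Q̄ Q|² = |Q|²|∇Q|²`» (printed proof: `|q₁ ⋆ q₂| = |q₁||q₂|`, then
«`|∇_Q Q|² + |∇_Q̄ Q|² = |∇Q|²` … the quaternion gradient decomposition identity», uncited). Pointwise, for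
smooth `u`. Feeds (89) and the Step-4 «energy barrier» (111).
[cite: Chishtie2025QuaternionNS, Lemma 5.2 (72) p.12, (88) p.14] [claim: Chishtie2025QuaternionNS, status: under-review] -/
def Step5_Lemma52 : Prop :=
  ∀ u : E3 → E3, ContDiff ℝ ∞ u → ∀ x : E3,
    ‖Qf u x * nablaQ (Qf u) x‖ ^ 2 + ‖star (Qf u x) * nablaQbar (Qf u) x‖ ^ 2 =
      ‖Qf u x‖ ^ 2 * gradNormSq (Qf u) x

/-- **Step 6 — the «conjugate gradient bound» (89) p.14:** «`‖∇_Q̄ Q‖²_{L²} ≤ C‖∇_Q Q‖_{L²}^{1/2}‖Q‖_{H¹}^{3/2}`»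
(printed proof (90)–(96) via (88), division by `|Q|²` and `|∇_Q Q|`, `H¹ ↪ L⁴`); one constant `C`, for all
smooth compactly supported divergence-free fields. Feeds (104).
[cite: Chishtie2025QuaternionNS, (89)–(96) p.14] [claim: Chishtie2025QuaternionNS, status: under-review] -/
def Step6_ConjugateBound89 : Prop :=
  ∃ C : ℝ, 0 ≤ C ∧ ∀ u : E3 → E3, ContDiff ℝ ∞ u → HasCompactSupport u → NSWave0.IsDivFree u →
    l2sq (nablaQbar (Qf u)) ≤
      C * Real.sqrt (Real.sqrt (l2sq (nablaQ (Qf u)))) * (Real.sqrt (h1sq u)) ^ (3 / 2 : ℝ)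

/-- **Step 7 — Lemma 5.3 p.12** [Quaternion Leibniz rule]: «For quaternion fields `A, B` and integer `s ≥ 0`:
`∇_Q^s(A ⋆ B) = Σ_{k=0}^{s} (s choose k) (∇_Q^k A) ⋆ (∇_Q^{s−k} B)`» («by induction on `s` using the product
rule»), used at (98)–(100) p.15. Pointwise, for smooth fields.
[cite: Chishtie2025QuaternionNS, Lemma 5.3 p.12; (98)–(100) p.15] [claim: Chishtie2025QuaternionNS, status: under-review] -/
def Step7_Lemma53 : Prop :=
  ∀ (s : ℕ) (A B : E3 → ℍ), ContDiff ℝ ∞ A → ContDiff ℝ ∞ B → ∀ x : E3,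
    nablaQPow s (fun y => A y * B y) x =
      ∑ k ∈ Finset.range (s + 1), (s.choose k : ℝ) • (nablaQPow k A x * nablaQPow (s - k) B x)

/-- **Step 8 — Lemma 5.4 (75) p.13** (Sobolev, `‖f‖_{L^∞} ≤ C‖f‖_{H^s}` for `s > 3/2`), in the instance used at
(103) p.15: one constant `C` with `|Q(x)| ≤ C‖Q‖_{H²}` for smooth compactly supported fields (`H²` rendered
by `hsq 2`). TRUE (classical); typed for completeness. [cite: Chishtie2025QuaternionNS, Lemma 5.4 (75) p.13, (103) p.15] -/
def Step8_Lemma54 : Prop :=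
  ∃ C : ℝ, 0 ≤ C ∧ ∀ u : E3 → E3, ContDiff ℝ ∞ u → HasCompactSupport u →
    ∀ x : E3, ‖Qf u x‖ ≤ C * Real.sqrt (hsq 2 u)

/-- **Step 9 — p.15, the passage to (107) at the grain of the displayed inequalities** (TYPING-HYGIENE 13).
At a fixed time write `A = ‖∇_Q^s Q‖_{L²}`, `D = ‖∇_Q^{s+1} Q‖_{L²}`, `X = ‖Q‖²_{H^s}` (so `A² ≤ X`),
`E' = d/dt‖∇_Q^s Q‖²_{L²}`, `N = Re⟨∇_Q^s(Q⋆∇_QQ + Q̄⋆∇_Q̄Q), ∇_Q^sQ⟩_{L²}`. The displays assert: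
(97) `½E' + νD² = −N`; (100) with (103) (k = 0 term, `‖Q‖_{L^∞} ≤ C‖Q‖_{H^s}`) and (104):
`|N| ≤ (C₁X^{1/2}D + C₂X^{3/4}D^{1/2})·A` (the `k ≥ 1` terms of (100) granted to vanish — the most favourable
case); (105) `νD² ≥ νλA²` with a «spectral gap» `λ > 0` (granted as a hypothesis); (106) Young. CLAIMED:
(107) `E' + (ν/2)D² ≤ C·X` with ONE constant `C` (depending on `ν, λ, C₁, C₂` only — it is the `C` of
(108)–(109)). [cite: Chishtie2025QuaternionNS, (97)–(107) p.15] [claim: Chishtie2025QuaternionNS, status: under-review] -/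
def Step9_Ineq107_abs : Prop :=
  ∀ ν lam C₁ C₂ : ℝ, 0 < ν → 0 < lam → 0 ≤ C₁ → 0 ≤ C₂ → ∃ C : ℝ, ∀ E' D A X N : ℝ,
    0 ≤ D → 0 ≤ A → A ^ 2 ≤ X →
    E' / 2 + ν * D ^ 2 = -N →
    |N| ≤ (C₁ * Real.sqrt X * D + C₂ * (Real.sqrt X * Real.sqrt (Real.sqrt X)) * Real.sqrt D) * A →
    ν * lam * A ^ 2 ≤ ν * D ^ 2 →
      E' + ν / 2 * D ^ 2 ≤ C * X

/-- **Step 10 — (107) p.15 at the solution grain** («for `s ≥ 1`», here every order `m ≥ 1`): there is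
`C = C(ν,ρ,m)` such that every smooth solution of (76)–(77) on `[0,T]` in the `H^m` class satisfies the
integrated form of `d/dt‖∇_Q^mQ‖² + (ν/2)‖∇_Q^{m+1}Q‖² ≤ C‖Q‖²_{H^m}`.
[cite: Chishtie2025QuaternionNS, (107) p.15] [claim: Chishtie2025QuaternionNS, status: under-review] -/
def Step10_Ineq107 : Prop :=
  ∀ ν ρ : ℝ, 0 < ν → 0 < ρ → ∀ m : ℕ, 1 ≤ m → ∃ C : ℝ, ∀ (T : ℝ) (u : ℝ → E3 → E3) (p : ℝ → E3 → ℝ),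
    0 < T → IsQNSSolutionOn (Icc 0 T) ν ρ u p → InHsClass m T u →
      ∀ t ∈ Icc 0 T,
        qn m (u t) + ν / 2 * ∫ τ in (0 : ℝ)..t, qn (m + 1) (u τ) ≤ qn m (u 0) + C * ∫ τ in (0 : ℝ)..t, hsq m (u τ)

/-- **(109) p.15 as an a-priori statement:** `X(t) ≤ X(0)e^{Ct}`, `X = ‖Q‖²_{H^s}`, with `C = C(ν,ρ,s)`, for
every smooth `H^s` solution of (76)–(77) on every `[0,T]`, every `s ≥ 3`.
[cite: Chishtie2025QuaternionNS, (109) p.15] [claim: Chishtie2025QuaternionNS, status: under-review] -/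
def GlobalHsBound109 : Prop :=
  ∀ ν ρ : ℝ, 0 < ν → 0 < ρ → ∀ s : ℕ, 3 ≤ s → ∃ C : ℝ, ∀ (T : ℝ) (u : ℝ → E3 → E3) (p : ℝ → E3 → ℝ),
    0 < T → IsQNSSolutionOn (Icc 0 T) ν ρ u p → InHsClass s T u →
      ∀ t ∈ Icc 0 T, hsq s (u t) ≤ hsq s (u 0) * Real.exp (C * t)

/-- The A-PRIORI `H^s` BOUND in the form continuation consumes (p.16 l.636 «`sup_{t ∈ [0,T*)}‖Q(t)‖_{H^s} < ∞`»):
on every `[0,T]`, solutions with `‖Q₀‖²_{H^s} ≤ R` stay bounded by some `M = M(ν,ρ,s,T,R)`.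
[cite: Chishtie2025QuaternionNS, Step 4 l.636 p.16] [claim: Chishtie2025QuaternionNS, status: under-review] -/
def AprioriHsBound : Prop :=
  ∀ ν ρ : ℝ, 0 < ν → 0 < ρ → ∀ s : ℕ, 3 ≤ s → ∀ T R : ℝ, 0 < T → ∃ M : ℝ,
    ∀ (u : ℝ → E3 → E3) (p : ℝ → E3 → ℝ), IsQNSSolutionOn (Icc 0 T) ν ρ u p → InHsClass s T u →
      hsq s (u 0) ≤ R → ∀ t ∈ Icc 0 T, hsq s (u t) ≤ M

/-- (109) gives the a-priori bound (`M = max R 0 · e^{|C|T}`; pure real arithmetic).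
[cite: Chishtie2025QuaternionNS, (109) p.15] -/
theorem aprioriHsBound_of_109 (h : GlobalHsBound109) : AprioriHsBound := by
  intro ν ρ hν hρ s hs T R hT
  obtain ⟨C, hC⟩ := h ν ρ hν hρ s hs
  refine ⟨max R 0 * Real.exp (|C| * T), fun u p hsol hcl hR t ht => ?_⟩
  have h1 := hC T u p hT hsol hcl t ht
  have h2 : Real.exp (C * t) ≤ Real.exp (|C| * T) := by
    apply Real.exp_le_exp.mpr
    calc C * t ≤ |C| * t := by exact mul_le_mul_of_nonneg_right (le_abs_self C) ht.1
      _ ≤ |C| * T := by exact mul_le_mul_of_nonneg_left ht.2 (abs_nonneg C)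
  have h0 : hsq s (u 0) ≤ max R 0 := le_trans hR (le_max_left _ _)
  calc hsq s (u t) ≤ hsq s (u 0) * Real.exp (C * t) := h1
    _ ≤ max R 0 * Real.exp (C * t) :=
        mul_le_mul_of_nonneg_right h0 (Real.exp_pos _).le
    _ ≤ max R 0 * Real.exp (|C| * T) :=
        mul_le_mul_of_nonneg_left h2 (le_max_right _ _)

/-- **Step 11 — Grönwall (108)–(109) p.15:** «Define `X(t) = ‖Q(t)‖²_{H^s}`. From (107): `dX/dt ≤ CX` … By
Grönwall's inequality: `X(t) ≤ X(0)e^{Ct}`» — typed as the printed implication from (107) (all orders,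
Step 10) and the order-zero identity (86) (Step 4) to (109). (Classical as an implication.)
[cite: Chishtie2025QuaternionNS, (108)–(109) p.15] [claim: Chishtie2025QuaternionNS, status: under-review] -/
def Step11_Gronwall109 : Prop := Step10_Ineq107 → Step4_EnergyEquality86 → GlobalHsBound109

/-- **Step 12 — Step 4 of the proof, «Energy barrier» (111)–(113) p.16, at the grain of the display:**
«from the fundamental energy balance (85) [`d/dt‖Q‖² + 2ν‖∇Q‖² = 0`] and constraint (88):
`‖∇_QQ(t)‖² + ‖∇_Q̄Q(t)‖² = ‖∇Q(t)‖²_{L²} ≤ ‖∇Q(0)‖²_{L²} ≤ C‖Q₀‖²_{H¹}`, which provides a uniform bound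
independent of time» — the middle inequality as an inference about the real functions `E(t) = ‖Q(t)‖²`,
`G(t) = ‖∇Q(t)‖²` on `[0,T]` from (85) (given in differential AND integrated form (86), with `E, G ≥ 0`,
`G` continuous): CLAIMED `G(t) ≤ G(0)`. [cite: Chishtie2025QuaternionNS, (111)–(113) p.16]
[claim: Chishtie2025QuaternionNS, status: under-review] -/
def Step12_Ineq112_abs : Prop :=
  ∀ (ν T : ℝ) (E G : ℝ → ℝ), 0 < ν → 0 < T → (∀ t ∈ Icc 0 T, 0 ≤ E t) → (∀ t ∈ Icc 0 T, 0 ≤ G t) →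
    Continuous G →
    (∀ t ∈ Icc 0 T, HasDerivAt E (-(2 * ν * G t)) t) →
    (∀ t ∈ Icc 0 T, E t + 2 * ν * ∫ τ in (0 : ℝ)..t, G τ = E 0) →
      ∀ t ∈ Icc 0 T, G t ≤ G 0

/-- **Step 13 — (113) p.16 at the solution grain:** one constant `C = C(ν,ρ)` with
`‖∇Q(t)‖²_{L²} ≤ C‖Q₀‖²_{H¹}` for every smooth `H^s` solution (`s ≥ 3`) of (76)–(77) on every `[0,T]` and every
`t ∈ [0,T]` («a uniform bound independent of time»).
[cite: Chishtie2025QuaternionNS, (113) p.16] [claim: Chishtie2025QuaternionNS, status: under-review] -/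
def Step13_Ineq113 : Prop :=
  ∀ ν ρ : ℝ, 0 < ν → 0 < ρ → ∃ C : ℝ, ∀ (T : ℝ) (s : ℕ) (u : ℝ → E3 → E3) (p : ℝ → E3 → ℝ),
    0 < T → 3 ≤ s → IsQNSSolutionOn (Icc 0 T) ν ρ u p → InHsClass s T u →
      ∀ t ∈ Icc 0 T, (∫ x, gradNormSq (Qf (u t)) x) ≤ C * h1sq (u 0)

/-- **Step 14 — p.16 l.636:** «This contradiction establishes `sup_{t ∈ [0,T*)}‖Q(t)‖_{H^s} < ∞`» — the passage
from the time-uniform gradient bound (113) to the a-priori `H^s` bound (no mechanism printed beyond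
(114)–(117)); typed as the implication. [cite: Chishtie2025QuaternionNS, Step 4 l.621–636 p.16]
[claim: Chishtie2025QuaternionNS, status: under-review] -/
def Step14_H1toHs : Prop := Step13_Ineq113 → AprioriHsBound

/-- **Step 15 — continuation and smoothness, p.16 l.636–639:** «by standard continuation theory, the solution
extends beyond `T*`. Since this argument applies for any finite time, global existence follows.
Smoothness: Once global `H^s` bounds are established for `s ≥ 3`, standard elliptic regularity theory for
the pressure and parabolic regularity for the quaternion field establish `C^∞` smoothness.» Typed as the
implication a-priori `H^s` bound ⇒ Theorem 5.5 (it presupposes a local well-posedness theory in `H^s` for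
the system (76)–(77), which is not cited). [cite: Chishtie2025QuaternionNS, Step 4 l.636–639 p.16]
[claim: Chishtie2025QuaternionNS, status: under-review] -/
def Step15_Continuation : Prop := AprioriHsBound → Thm55

/-! ## The transfer `Q ↔ u` (proof of Corollary 5.6, p.17) — PROVED from Step 1 -/

/-- **Cor 5.6 from Thm 5.5, GIVEN (20):** if the convection decomposition (20) holds for smooth
divergence-free fields, a smooth solution of (76)–(77) at `ρ = 1` IS a smooth solution of (118)–(119)
(componentwise reading of `∂_t`, `∇_Q p`, `∇²`; `quatOf` injective), so Theorem 5.5 yields Corollary 5.6 —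
the printed «isomorphism `u ↔ Q` … preserves the nonlinear structure» (l.659–661). Kernel-checked.
[cite: Chishtie2025QuaternionNS, Cor 5.6 proof p.17] -/
theorem cor56_of_thm55 (h1 : Step1_Convection20) (h55 : Thm55) : Cor56 := by
  intro ν hν u₀ hu₀ hdiv hdata
  obtain ⟨u, p, hsol, h0⟩ := h55 ν 1 hν one_pos u₀ hu₀ hdiv hdata
  refine ⟨u, p, hsol.smooth_velocity, hsol.smooth_pressure, ?_, trivial⟩
  refine ⟨?_, fun t ht => hsol.divFree t (mem_Ici.mpr ht), h0⟩
  intro t ht x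
  have ht' : t ∈ Ici (0 : ℝ) := mem_Ici.mpr ht
  have hm := hsol.momentum t ht' x
  have hst : ContDiff ℝ ∞ (u t) := hsol.smooth_velocity.contDiff_slice ht'
  have h20 := h1 (u t) hst (hsol.divFree t ht') x
  rw [← h20] at hm
  -- `hm : quatOf (∂ₜu) + quatOf ((u·∇)u) = -(1/1) • quatOf (∇p) + ν • quatOf (Δu)`
  have hq : quatOf (timeDerivWithin (Ici 0) u t x + convect (u t) (u t) x) =
      quatOf (ν • Δ (u t) x - gradient (p t) x) := by
    rw [quatOf_add, hm, sub_eq_add_neg, quatOf_add, quatOf_smul, quatOf_neg]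
    simp only [ne_eq, one_ne_zero, not_false_eq_true, div_self, neg_smul, one_smul]
    abel
  have hv := congrArg vecOf hq
  rw [vecOf_quatOf, vecOf_quatOf] at hv
  rw [timeDerivWithin_apply, convect_apply] at hv
  rw [hv]
  simp

/-! ## Composition and Clay link -/

/-- **COMPOSITION (Step-3 route), PROVED:** Steps 1–15 imply the claimed theorem — Thm 5.5 from
Step 10 → Step 11 (with Step 4) → (109) → a-priori bound → Step 15; Cor 5.6 from Step 1 and Thm 5.5
(`cor56_of_thm55`). Steps 2, 3, 5–9, 12–14 are displayed inputs of the printed proofs (`_` binders).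
[cite: Chishtie2025QuaternionNS, §5.3–5.4 p.13–17] -/
theorem claim_of_steps (h1 : Step1_Convection20) (_h2 : Step2_Lemma51) (_h3a : Step3a_Orthogonality83)
    (_h3b : Step3b_Orthogonality84) (h4 : Step4_EnergyEquality86) (_h5 : Step5_Lemma52)
    (_h6 : Step6_ConjugateBound89) (_h7 : Step7_Lemma53) (_h8 : Step8_Lemma54) (_h9 : Step9_Ineq107_abs)
    (h10 : Step10_Ineq107) (h11 : Step11_Gronwall109) (_h12 : Step12_Ineq112_abs) (_h13 : Step13_Ineq113)
    (_h14 : Step14_H1toHs) (h15 : Step15_Continuation) : ClaimedTheorem :=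
  have h55 : Thm55 := h15 (aprioriHsBound_of_109 (h11 h10 h4))
  ⟨h55, cor56_of_thm55 h1 h55⟩

/-- **COMPOSITION (the paper's Step-4 route), PROVED:** Step 13 → Step 14 → Step 15 ⇒ Thm 5.5, and Cor 5.6
by Step 1. [cite: Chishtie2025QuaternionNS, Step 4 p.16, Cor 5.6 p.17] -/
theorem claim_of_steps_via_step4 (h1 : Step1_Convection20) (h13 : Step13_Ineq113) (h14 : Step14_H1toHs)
    (h15 : Step15_Continuation) : ClaimedTheorem :=
  have h55 : Thm55 := h15 (h14 h13)
  ⟨h55, cor56_of_thm55 h1 h55⟩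

/-- Δ4 (the good direction): Clay's rapidly decaying smooth data (4) are `H^s` data for every `s` — a smooth
function all of whose derivatives are `O((1+|x|)^{-2})` has them in `L²(ℝ³)`.
[cite: FeffermanClay2006, (4) p.1] -/
theorem hsData_of_hasRapidSpatialDecay {u₀ : E3 → E3} (hu : ContDiff ℝ ∞ u₀)
    (hd : HasRapidSpatialDecay u₀) : HsData u₀ := by
  refine ⟨3, le_rfl, fun m _ => ?_⟩
  obtain ⟨C, hC⟩ := hd m 2
  have hcont : Continuous (iteratedFDeriv ℝ m u₀) :=
    hu.continuous_iteratedFDeriv (by exact_mod_cast le_top)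
  have hmeas : AEStronglyMeasurable (iteratedFDeriv ℝ m u₀) (volume : Measure E3) :=
    hcont.aestronglyMeasurable
  -- domination by the integrable radial weight `(1+|x|)^{-2}` (squared: `(1+|x|)^{-4}`, `4 > 3 = dim`)
  have hint : Integrable (fun x : E3 => (1 + ‖x‖) ^ (-(4 : ℝ))) (volume : Measure E3) := by
    apply integrable_one_add_norm
    simp [finrank_euclideanSpace]
    norm_num
  have hC0 : 0 ≤ C := by
    have := hC 0
    have h1 : (0 : ℝ) ≤ (1 + ‖(0 : E3)‖) ^ 2 * ‖iteratedFDeriv ℝ m u₀ 0‖ := by positivity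
    linarith
  refine (memLp_two_iff_integrable_sq_norm hmeas).mpr ?_
  refine Integrable.mono' (hint.const_mul (C ^ 2)) (hmeas.norm.pow 2) ?_
  refine Filter.Eventually.of_forall fun x => ?_
  have hx : 0 < 1 + ‖x‖ := by positivity
  have hb := hC x
  have hle : ‖iteratedFDeriv ℝ m u₀ x‖ ≤ C * (1 + ‖x‖) ^ (-(2 : ℝ)) := by
    rw [Real.rpow_neg hx.le, ← div_eq_mul_inv, le_div_iff₀ (by positivity)]
    calc ‖iteratedFDeriv ℝ m u₀ x‖ * (1 + ‖x‖) ^ (2 : ℝ)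
        = (1 + ‖x‖) ^ 2 * ‖iteratedFDeriv ℝ m u₀ x‖ := by
          rw [mul_comm]; norm_cast
      _ ≤ C := hb
  have hnn : 0 ≤ ‖iteratedFDeriv ℝ m u₀ x‖ := norm_nonneg _
  rw [Real.norm_eq_abs, abs_of_nonneg (by positivity)]
  calc ‖iteratedFDeriv ℝ m u₀ x‖ ^ 2 ≤ (C * (1 + ‖x‖) ^ (-(2 : ℝ))) ^ 2 :=
        pow_le_pow_left₀ hnn hle 2
    _ = C ^ 2 * (1 + ‖x‖) ^ (-(4 : ℝ)) := by
        rw [mul_pow, ← Real.rpow_natCast ((1 + ‖x‖) ^ (-(2 : ℝ))) 2, ← Real.rpow_mul hx.le]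
        norm_num

/-- **The Clay delta (Δ6 FORM OF THE CONCLUSION):** Corollary 5.6 prints a global smooth solution with NO
side condition; Clay (A) asks in addition for bounded energy (7). `ClayDelta` is exactly the upgrade of the
printed conclusion to the spec with (7) as its side condition (same data class). Not printed, not proved.
[cite: FeffermanClay2006, (7) and (A) p.1–2] [cite: Chishtie2025QuaternionNS, Cor 5.6 p.17] -/
def ClayDelta : Prop :=
  Cor56 → ({ chishtieSpec with admissible := fun u _ => HasBoundedEnergy u } : ClayVariants.ClaySpec).Regularity

/-- Under `ClayDelta`, the claimed theorem implies Clay (A) (`Regularity.mono`: Clay data are `H^s` data —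
`hsData_of_hasRapidSpatialDecay` composed with the schema's `C^∞` hypothesis — and the side conditions
agree). `clay_of_claimed` itself is NOT provable (Δ6). [cite: FeffermanClay2006, (A) p.2] -/
theorem clay_of_claimed_of_delta (hΔ : ClayDelta) (h : ClaimedTheorem) : ClayVariants.clayR3.Regularity := by
  have hE := hΔ h.2
  intro ν hν u₀ hu₀ hdiv hdata
  obtain ⟨u, p, hu, hp, hsol, hS⟩ := hE ν hν u₀ hu₀ hdiv (hsData_of_hasRapidSpatialDecay hu₀ hdata)
  exact ⟨u, p, hu, hp, hsol, hS⟩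

end

/-! ## Kernel certificate for Step 3a — the orthogonality (83) p.13–14 (append-only, D-0026 debt)

`Re⟨Q ⋆ ∇_Q Q, Q⟩_{L²} = ∫ Re[(Q ⋆ ∇_Q Q) ⋆ Q̄] dx = 0` for every smooth compactly supported
divergence-free `u`: the integrand vanishes POINTWISE — `Re[(Q ⋆ A) ⋆ Q̄] = |Q|² Re A` for quaternions and
`Re(∇_Q Q) = −div u = 0` (`Q = u i + v j + w k` purely imaginary); no mathematics beyond the quaternion
product rule (Lemma 5.1 = `step2_holds`). This Step was typed «true»; it is not the adjudicated locator of
C37 (#72, `Step1_Convection20`) and nothing in the verdict / locator / class / statements changes. FIRST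
KERNEL PROOF (Summits side, not importable from `Literature/`):
`Summit.NavierStokesRegularity.NavierStokesRegularity.Theorems.Chishtie2025Salvage.chishtie2025_step3a_holds`
(`Theorems/SoloSalvageChishtie2025.lean`, seat ns-claims-salvage-p3) — this in-file copy (same proof) exists
only so that the Literature-side fact `Step3a_Orthogonality83` carries its `_holds` (D-0026 census). -/

section Step3aCertificate

/-- The integrand of (83) vanishes pointwise for a divergence-free smooth field:
`Re[(Q ⋆ ∇_Q Q) ⋆ Q̄](x) = 0`. (Proof device.) [cite: Chishtie2025QuaternionNS, (79)–(84) p.13–14] -/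
private theorem re_convQ_mul_star_eq_zero {u : E3 → E3} (hu : ContDiff ℝ ∞ u)
    (hdiv : NSWave0.IsDivFree u) (x : E3) :
    ((Qf u x * nablaQ (Qf u) x) * star (Qf u x)).re = 0 := by
  have hdx : HasFDerivAt u (fderiv ℝ u x) x := ((hu.differentiable (by simp)) x).hasFDerivAt
  have hpd : ∀ j, pd j (Qf u) x = quatOf (fderiv ℝ u x (e j)) := fun j => pd_Qf hdx j
  -- `div u (x) = Σ_j (Du(x) e_j)_j = 0`
  have hdiv' : fderiv ℝ u x (e 0) 0 + fderiv ℝ u x (e 1) 1 + fderiv ℝ u x (e 2) 2 = 0 := by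
    have h := hdiv x
    change VectorCalculus.divergence u x = 0 at h
    rw [divergence_eq_sum_inner_fderiv (EuclideanSpace.basisFun (Fin 3) ℝ), Fin.sum_univ_three] at h
    simpa [e, EuclideanSpace.basisFun_apply, EuclideanSpace.inner_single_left] using h
  rw [nablaQ, hpd 0, hpd 1, hpd 2]
  simp only [Qf, quatOf, qi, qj, qk, Quaternion.re_mul, Quaternion.imI_mul, Quaternion.imJ_mul,
    Quaternion.imK_mul, Quaternion.re_add, Quaternion.imI_add, Quaternion.imJ_add, Quaternion.imK_add,
    Quaternion.re_star, Quaternion.imI_star, Quaternion.imJ_star, Quaternion.imK_star]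
  linear_combination (-(u x 0 ^ 2 + u x 1 ^ 2 + u x 2 ^ 2)) * hdiv'

/-- **Step 3a ((83) p.13–14) is a THEOREM**: `∫ Re[(Q ⋆ ∇_Q Q) ⋆ Q̄] dx = 0` for smooth compactly
supported divergence-free `u` (the integrand is identically zero, `re_convQ_mul_star_eq_zero`).
Literature-side twin of the Summits-side
`Summit.NavierStokesRegularity.NavierStokesRegularity.Theorems.Chishtie2025Salvage.chishtie2025_step3a_holds`.
[cite: Chishtie2025QuaternionNS, (79)–(84) p.13–14] -/
theorem step3a_Orthogonality83_holds : Step3a_Orthogonality83 := by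
  intro u hu _hc hdiv
  simp_rw [re_convQ_mul_star_eq_zero hu hdiv]
  exact integral_zero _ _

end Step3aCertificate

/-! ## Kernel certificate for Step 8 — Lemma 5.4 (75) p.13, `H² ⊂ L^∞` (append-only, D-0026 debt;
ns-claims-typist-9 g5, 2026-08-27)

`Step8_Lemma54` (TRUE, classical; typed «for completeness», not the adjudicated locator of C37) is PROVED
from the tree's whole-space Agmon inequality `norm_apply_le_agmon`
(`‖u(x)‖ ≤ A (∫|∇u|²)^{1/4} (∫|∇²u|²)^{1/4}`, Robinson–Rodrigo–Sadowski 2016 Thm 1.20) and two bookkeeping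
facts about the paper's quaternionic norms: pointwise `∇_Q(∇_Q F) = −ΔF` for a `C²` quaternion field (the
units `i, j, k` anticommute and mixed partials commute), so that `‖∇_Q² Q‖²_{L²} = ‖Δu‖²_{L²} = ∫|∇²u|²`
(`integral_levelSq_two_eq_integral_laplacian_sq`), and the interpolation `∫|∇u|² ≤ ‖u‖_{L²}‖Δu‖_{L²}`
(Green's identity without boundary `integral_inner_laplacian_add_eq_zero` + Cauchy–Schwarz), which lets the
mixed term `‖∇_Q Q‖²_{L²} ≥ 0` be dropped: `(a₁a₂)^{1/4} ≤ ((a₀a₂)^{1/2}a₂)^{1/4} ≤ (a₀ + a₂)^{1/2} ≤ √(hsq 2 u)`.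
Nothing in the verdict / locator / class / statements of C37 changes. -/

section Step8Certificate

open scoped RealInnerProductSpace

/-- `∫ ‖g‖ₑ² < ∞` for a continuous compactly supported function on `ℝ³`. [folklore] -/
private theorem lintegral_enorm_sq_lt_top_cc {F : Type*} [NormedAddCommGroup F] {g : E3 → F}
    (hg : Continuous g) (hs : HasCompactSupport g) : ∫⁻ x, ‖g x‖ₑ ^ 2 < ⊤ := by
  have h2 : HasCompactSupport fun x => ‖g x‖ ^ 2 :=
    hs.norm.comp_left (g := fun t : ℝ => t ^ 2) (by norm_num)
  have hc2 : Continuous fun x => ‖g x‖ ^ 2 := hg.norm.pow 2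
  have h := (hc2.integrable_of_hasCompactSupport (μ := (volume : Measure E3)) h2).hasFiniteIntegral
  rw [hasFiniteIntegral_iff_enorm] at h
  refine lt_of_le_of_lt (le_of_eq (lintegral_congr fun x => ?_)) h
  rw [Real.enorm_eq_ofReal (sq_nonneg _), ENNReal.ofReal_pow (norm_nonneg _), ofReal_norm]

/-- `∫ ‖Dᵏu‖ₑ² < ∞` for a smooth compactly supported field. [folklore] -/
private theorem lintegral_iteratedFDeriv_sq_lt_top_cc {u : E3 → E3} (hu : ContDiff ℝ ∞ u)
    (hc : HasCompactSupport u) (k : ℕ) : ∫⁻ x, ‖iteratedFDeriv ℝ k u x‖ₑ ^ 2 < ⊤ :=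
  lintegral_enorm_sq_lt_top_cc (hu.continuous_iteratedFDeriv (by exact_mod_cast le_top))
    (hc.iteratedFDeriv k)

/-- **Quaternion units anticommute**: for a SYMMETRIC family `H a b = H b a` of quaternions (the second
partials), `Σ_b q_b Σ_a q_a H b a = −(H 0 0 + H 1 1 + H 2 2)` (`i² = j² = k² = −1`, `ij = −ji`, …).
[cite: Chishtie2025QuaternionNS, (18)–(19) p.7, (66) p.11] -/
private theorem quat_double_sum_eq_neg_trace (H : Fin 3 → Fin 3 → ℍ) (hH : ∀ a b, H a b = H b a) :
    qi * (qi * H 0 0 + qj * H 0 1 + qk * H 0 2) + qj * (qi * H 1 0 + qj * H 1 1 + qk * H 1 2) +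
        qk * (qi * H 2 0 + qj * H 2 1 + qk * H 2 2) = -(H 0 0 + H 1 1 + H 2 2) := by
  rw [hH 1 0, hH 2 0, hH 2 1]
  ext <;> simp [qi, qj, qk] <;> ring

/-- **`∇_Q(∇_Q F) = −ΔF` pointwise** for a `C²` quaternion field on `ℝ³`: with `∂_b(q_a ∂_a F) = q_a ∂_b∂_a F`,
the symmetry of second partials and the anticommutation of the units, only `i²∂ₓ² + j²∂_y² + k²∂_z² = −Δ`
survives. [cite: Chishtie2025QuaternionNS, (19) p.7, (69) p.12, (97) p.15] -/
theorem nablaQ_nablaQ_eq_neg_laplacian {F : E3 → ℍ} (hF : ContDiff ℝ 2 F) (x : E3) :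
    nablaQ (nablaQ F) x = -(Δ F) x := by
  set b := EuclideanSpace.basisFun (Fin 3) ℝ with hb
  have he : ∀ j, e j = b j := fun j => by simp [e, hb]
  -- second partials
  set H : Fin 3 → Fin 3 → ℍ := fun c a => fderiv ℝ (fderiv ℝ F) x (e c) (e a) with hHdef
  have hsymm : ∀ a c, H a c = H c a := fun a c =>
    (hF.contDiffAt.isSymmSndFDerivAt (by simp)) (e a) (e c)
  have hd2 : DifferentiableAt ℝ (fderiv ℝ F) x :=
    ((hF.fderiv_right (m := 1) le_rfl).differentiable one_ne_zero) x
  -- derivative of `y ↦ ∂_a F (y)`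
  have hpd : ∀ a, HasFDerivAt (fun y => pd a F y) (fderiv ℝ (fun y => fderiv ℝ F y (e a)) x) x :=
    fun a => ((hd2.clm_apply (differentiableAt_const (e a)))).hasFDerivAt
  have hpd_apply : ∀ a c, fderiv ℝ (fun y => fderiv ℝ F y (e a)) x (e c) = H c a := by
    intro a c
    rw [fderiv_clm_apply hd2 (differentiableAt_const (e a))]
    simp [hHdef]
  -- derivative of `∇_Q F`
  have hG : HasFDerivAt (nablaQ F)
      (qi • fderiv ℝ (fun y => fderiv ℝ F y (e 0)) x + qj • fderiv ℝ (fun y => fderiv ℝ F y (e 1)) x +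
        qk • fderiv ℝ (fun y => fderiv ℝ F y (e 2)) x) x :=
    (((hpd 0).const_mul qi).add ((hpd 1).const_mul qj)).add ((hpd 2).const_mul qk)
  have hpdG : ∀ c, pd c (nablaQ F) x = qi * H c 0 + qj * H c 1 + qk * H c 2 := by
    intro c
    rw [pd, hG.fderiv]
    simp [hpd_apply]
  rw [nablaQ, hpdG 0, hpdG 1, hpdG 2, quat_double_sum_eq_neg_trace H (fun a c => hsymm a c),
    laplacian_apply_eq_sum_fderiv_fderiv b F x, Fin.sum_univ_three, ← he 0, ← he 1, ← he 2]

/-- `∇_Q²Q = −ΔQ = −(Δu) i − …`: `‖∇_Q² (Qf u)(x)‖ = ‖Δu(x)‖` for a `C²` field.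
[cite: Chishtie2025QuaternionNS, (97) p.15] -/
theorem norm_nablaQPow_two_Qf {u : E3 → E3} (hu : ContDiff ℝ 2 u) (x : E3) :
    ‖nablaQPow 2 (Qf u) x‖ = ‖(Δ u) x‖ := by
  have hF : ContDiff ℝ 2 (Qf u) := quatOfL.contDiff.comp hu
  have h2 : nablaQPow 2 (Qf u) = nablaQ (nablaQ (Qf u)) := by
    simp [nablaQPow, Function.iterate_succ]
  have hQ : Qf u = quatOfL ∘ u := rfl
  rw [h2, nablaQ_nablaQ_eq_neg_laplacian hF, norm_neg, hQ, hu.contDiffAt.laplacian_CLM_comp_left]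
  simp [norm_quatOf]

/-- `‖Q‖²_{L²} = ∫ |u|² = ∫ levelSq 0 u`. [cite: Chishtie2025QuaternionNS, (17) p.7, (78) p.13] -/
theorem qn_zero_eq_integral_levelSq (u : E3 → E3) : qn 0 u = ∫ x, levelSq 0 u x := by
  simp only [qn, l2sq, nablaQPow, Function.iterate_zero, id, Qf, norm_quatOf, levelSq_zero_eq_norm_sq]

/-- `‖∇_Q² Q‖²_{L²} = ∫ ‖Δu‖² = ∫ |∇²u|²` for a smooth compactly supported field (Hessian–Laplacian
identity `integral_levelSq_two_eq_integral_laplacian_sq`). [cite: Chishtie2025QuaternionNS, (97), (108) p.15] -/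
theorem qn_two_eq_integral_levelSq {u : E3 → E3} (hu : ContDiff ℝ ∞ u) (hc : HasCompactSupport u) :
    qn 2 u = ∫ x, levelSq 2 u x := by
  rw [integral_levelSq_two_eq_integral_laplacian_sq (hu.of_le (by norm_cast))
    (lintegral_iteratedFDeriv_sq_lt_top_cc hu hc 1) (lintegral_iteratedFDeriv_sq_lt_top_cc hu hc 2)
    (lintegral_iteratedFDeriv_sq_lt_top_cc hu hc 3)]
  simp only [qn, l2sq]
  refine integral_congr_ae (Eventually.of_forall fun x => ?_)
  show ‖nablaQPow 2 (Qf u) x‖ ^ 2 = ‖(Δ u) x‖ ^ 2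
  rw [norm_nablaQPow_two_Qf (hu.of_le (by norm_cast)) x]

/-- **Interpolation `∫|∇u|² ≤ ‖u‖_{L²} ‖Δu‖_{L²}`** for a smooth compactly supported field: Green's identity
without boundary `∫⟪Δu, u⟫ + Σᵢ∫‖∂ᵢu‖² = 0` and Cauchy–Schwarz. (Private helper.) [folklore] -/
private theorem integral_levelSq_one_le_sqrt_mul_sqrt {u : E3 → E3} (hu : ContDiff ℝ ∞ u)
    (hc : HasCompactSupport u) :
    ∫ x, levelSq 1 u x ≤ Real.sqrt (∫ x, levelSq 0 u x) * Real.sqrt (∫ x, levelSq 2 u x) := by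
  set b := EuclideanSpace.basisFun (Fin 3) ℝ with hb
  have hu2 : ContDiff ℝ 2 u := hu.of_le (by norm_cast)
  have hu1 : ContDiff ℝ 1 u := hu.of_le (by norm_cast)
  have hdiff : ∀ x, DifferentiableAt ℝ u x := fun x => (hu1.differentiable one_ne_zero) x
  -- `∫ levelSq 1 u = Σᵢ ∫ ‖∂ᵢu‖²`
  have hint_i : ∀ i, Integrable (fun x => ‖fderiv ℝ u x (b i)‖ ^ 2) (volume : Measure E3) := by
    intro i
    have hci : Continuous fun x => ‖fderiv ℝ u x (b i)‖ ^ 2 :=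
      ((hu.continuous_fderiv (by simp)).clm_apply continuous_const).norm.pow 2
    have hsi : HasCompactSupport ((fun t : ℝ => t ^ 2) ∘ fun x => ‖fderiv ℝ u x (b i)‖) :=
      (hc.fderiv_apply (𝕜 := ℝ) (b i)).norm.comp_left (by norm_num)
    exact hci.integrable_of_hasCompactSupport hsi
  have hlev : ∫ x, levelSq 1 u x = ∑ i, ∫ x, ‖fderiv ℝ u x (b i)‖ ^ 2 := by
    rw [← integral_finsetSum _ fun i _ => hint_i i]
    refine integral_congr_ae (Eventually.of_forall fun x => ?_)
    rw [levelSq_one_eq_frobeniusNormSq (hdiff x), frobeniusNormSq_eq_sum b]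
  -- Green's identity without boundary
  have hgreen := integral_inner_laplacian_add_eq_zero b hu2 hu1 (Or.inl hc)
  have hsq : ∑ i, ∫ x, ⟪fderiv ℝ u x (b i), fderiv ℝ u x (b i)⟫ = ∑ i, ∫ x, ‖fderiv ℝ u x (b i)‖ ^ 2 :=
    Finset.sum_congr rfl fun i _ => integral_congr_ae (Eventually.of_forall fun x =>
      real_inner_self_eq_norm_sq _)
  have hkey : ∫ x, levelSq 1 u x = -∫ x, ⟪(Δ u) x, u x⟫ := by
    rw [hlev, ← hsq]; linarith
  -- Cauchy–Schwarz
  have hD2 : ContDiff ℝ 1 (fderiv ℝ u) := hu2.fderiv_right (m := 1) (by norm_num)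
  have hD2c : Continuous (fderiv ℝ (fderiv ℝ u)) := hD2.continuous_fderiv one_ne_zero
  have hΔeq : (Δ u) = fun x => ∑ i, fderiv ℝ (fderiv ℝ u) x (b i) (b i) :=
    funext fun x => laplacian_apply_eq_sum_fderiv_fderiv b u x
  have hcΔ : Continuous (Δ u) := by
    rw [hΔeq]
    exact continuous_finsetSum _ fun i _ => (hD2c.clm_apply continuous_const).clm_apply continuous_const
  have hsΔ : HasCompactSupport (Δ u) := by
    rw [hΔeq]
    refine ((hc.fderiv (𝕜 := ℝ)).fderiv (𝕜 := ℝ)).mono' fun x hx => ?_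
    by_contra h
    have h0 : fderiv ℝ (fderiv ℝ u) x = 0 := image_eq_zero_of_notMem_tsupport h
    exact hx (by simp [h0])
  have hΔ2 : MemLp (Δ u) 2 (volume : Measure E3) := hcΔ.memLp_of_hasCompactSupport hsΔ
  have hu0 : MemLp u 2 (volume : Measure E3) := hu.continuous.memLp_of_hasCompactSupport hc
  have hcs0 : |∫ x, ⟪(Δ u) x, u x⟫| ≤ ∫ x, ‖(Δ u) x‖ * ‖u x‖ := by
    rw [← Real.norm_eq_abs]
    exact (norm_integral_le_integral_norm _).trans (integral_mono_of_nonneg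
      (ae_of_all _ fun x => norm_nonneg _) (hΔ2.norm.integrable_mul hu0.norm)
      (ae_of_all _ fun x => norm_inner_le_norm _ _))
  have hcs := hcs0.trans (integral_norm_mul_norm_le_sqrt_mul_sqrt hΔ2 hu0)
  have hΔlev : ∫ x, ‖(Δ u) x‖ ^ 2 = ∫ x, levelSq 2 u x :=
    (integral_levelSq_two_eq_integral_laplacian_sq (hu.of_le (by norm_cast))
      (lintegral_iteratedFDeriv_sq_lt_top_cc hu hc 1) (lintegral_iteratedFDeriv_sq_lt_top_cc hu hc 2)
      (lintegral_iteratedFDeriv_sq_lt_top_cc hu hc 3)).symm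
  have h0lev : ∫ x, ‖u x‖ ^ 2 = ∫ x, levelSq 0 u x :=
    integral_congr_ae (Eventually.of_forall fun x => (levelSq_zero_eq_norm_sq u x).symm)
  rw [hkey, ← h0lev, ← hΔlev, mul_comm]
  exact (neg_le_abs _).trans hcs

/-- **Step 8 (Lemma 5.4 (75) p.13 at the instance (103) p.15) is a THEOREM**: one constant `C` (the tree's
Agmon constant) with `|Q(x)| ≤ C‖Q‖_{H²}` for every smooth compactly supported field, `‖Q‖²_{H²}` rendered
as `hsq 2 u = ‖Q‖²_{L²} + ‖∇_QQ‖²_{L²} + ‖∇_Q²Q‖²_{L²}`. Whole-space Agmon `‖u‖_∞ ≤ A‖∇u‖^{1/2}_{L²}‖∇²u‖^{1/2}_{L²}`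
(Robinson–Rodrigo–Sadowski 2016, Thm 1.20; tree `norm_apply_le_agmon`) with `∫|∇u|² ≤ ‖u‖‖Δu‖` and
`‖∇_Q²Q‖_{L²} = ‖Δu‖_{L²}`. [cite: Chishtie2025QuaternionNS, Lemma 5.4 (75) p.13, (103) p.15]
[cite: RobinsonRodrigoSadowskiCUP2016, Thm 1.20] -/
theorem step8_Lemma54_holds : Step8_Lemma54 := by
  refine ⟨agmonConst, agmonConst_nonneg, fun u hu hc x => ?_⟩
  -- the three coordinate Sobolev integrals
  have hL : ∀ m, Integrable (levelSq m u) := fun m =>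
    (integrable_levelSq_of_lintegral_lt_top hu m (lintegral_iteratedFDeriv_sq_lt_top_cc hu hc m)).1
  set a₀ := ∫ y, levelSq 0 u y with ha₀
  set a₁ := ∫ y, levelSq 1 u y with ha₁
  set a₂ := ∫ y, levelSq 2 u y with ha₂
  have h0 : 0 ≤ a₀ := integral_nonneg fun y => levelSq_nonneg 0 u y
  have h1 : 0 ≤ a₁ := integral_nonneg fun y => levelSq_nonneg 1 u y
  have h2 : 0 ≤ a₂ := integral_nonneg fun y => levelSq_nonneg 2 u y
  -- Agmon
  have hag : ‖u x‖ ≤ agmonConst * (a₁ * a₂) ^ (1 / 4 : ℝ) := norm_apply_le_agmon hu (hL 0) (hL 1) (hL 2) x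
  -- interpolation and the `H²`-type quantity
  have hint : a₁ ≤ Real.sqrt a₀ * Real.sqrt a₂ := integral_levelSq_one_le_sqrt_mul_sqrt hu hc
  set S := a₀ + a₂ with hS
  have hS0 : 0 ≤ S := add_nonneg h0 h2
  have hqn1 : 0 ≤ qn 1 u := integral_nonneg fun y => sq_nonneg _
  have hhsq : S ≤ hsq 2 u := by
    have : hsq 2 u = qn 0 u + qn 1 u + qn 2 u := by
      simp [hsq, Finset.sum_range_succ]
    rw [this, qn_zero_eq_integral_levelSq, qn_two_eq_integral_levelSq hu hc]
    linarith
  -- `(a₁ a₂)^{1/4} ≤ √S`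
  have hprod : a₁ * a₂ ≤ S ^ 2 := by
    have ha0S : Real.sqrt a₀ ≤ Real.sqrt S := Real.sqrt_le_sqrt (by linarith)
    have ha2S : Real.sqrt a₂ ≤ Real.sqrt S := Real.sqrt_le_sqrt (by linarith)
    have hSS : Real.sqrt S * Real.sqrt S = S := Real.mul_self_sqrt hS0
    calc a₁ * a₂ ≤ (Real.sqrt a₀ * Real.sqrt a₂) * a₂ := mul_le_mul_of_nonneg_right hint h2
      _ ≤ (Real.sqrt S * Real.sqrt S) * S := by
          refine mul_le_mul (mul_le_mul ha0S ha2S (Real.sqrt_nonneg _) (Real.sqrt_nonneg _))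
            (by linarith) h2 (mul_nonneg (Real.sqrt_nonneg _) (Real.sqrt_nonneg _))
      _ = S ^ 2 := by rw [hSS, sq]
  have hroot : (a₁ * a₂) ^ (1 / 4 : ℝ) ≤ Real.sqrt S := by
    have h14 : (a₁ * a₂) ^ (1 / 4 : ℝ) ≤ (S ^ 2) ^ (1 / 4 : ℝ) :=
      Real.rpow_le_rpow (mul_nonneg h1 h2) hprod (by norm_num)
    refine h14.trans (le_of_eq ?_)
    rw [Real.sqrt_eq_rpow, ← Real.rpow_natCast S 2, ← Real.rpow_mul hS0]
    norm_num
  calc ‖Qf u x‖ = ‖u x‖ := norm_quatOf (u x)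
    _ ≤ agmonConst * (a₁ * a₂) ^ (1 / 4 : ℝ) := hag
    _ ≤ agmonConst * Real.sqrt S := mul_le_mul_of_nonneg_left hroot agmonConst_nonneg
    _ ≤ agmonConst * Real.sqrt (hsq 2 u) :=
        mul_le_mul_of_nonneg_left (Real.sqrt_le_sqrt hhsq) agmonConst_nonneg

/-- `Step8_Lemma54` — `_holds` alias of `step8_Lemma54_holds` above under the fact's exact name (appended
2026-08-28, D-0026 bookkeeping: the proof term is the existing theorem of this file; no statement,
definition or attribute is edited; no new named fact; the ledger's debt table listed the fact
unproved). [cite: RobinsonRodrigoSadowskiCUP2016, Thm 1.20] -/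
theorem _root_.Literature.Claims.NS.Chishtie2025.Step8_Lemma54_holds : Step8_Lemma54 :=
  _root_.Literature.Claims.NS.Chishtie2025.step8_Lemma54_holds

end Step8Certificate

/-! ## Step 6 certificate ((89) p.14): `Step6_ConjugateBound89` holds with `C = 3` (D-0026 debt pass)

Pointwise `‖∇_{Q̄} Q‖ ≤ ‖∂₀Q‖ + ‖∂₁Q‖ + ‖∂₂Q‖` (unit quaternions), so `‖∇_{Q̄}Q‖²_{L²} ≤ 3‖∇u‖²_{L²}`; for a
divergence-free field `∇_Q Q = quatOf (curl u)` pointwise (its real part is `−div u`), and the whole-space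
`div`–`curl` estimate `∫|Du|²_F ≤ ∫‖curl u‖²` (`lintegral_frobeniusNormSq_fderiv_le_lintegral_sq_norm_curl`)
gives `‖∇u‖²_{L²} ≤ ‖∇_Q Q‖²_{L²}`; hence
`‖∇_{Q̄}Q‖²_{L²} ≤ 3‖∇u‖²_{L²} = 3‖∇u‖^{1/2}‖∇u‖^{3/2} ≤ 3 ‖∇_Q Q‖^{1/2}_{L²} ‖Q‖^{3/2}_{H¹}`. The printed route
(90)–(96) (division by `|Q|²` and by `|∇_Q Q|`, `H¹ ⊂ L⁴`) is not used. -/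

section Step6Certificate

variable {u : E3 → E3}

/-- `quatOf 0 = 0`. [cite: Chishtie2025QuaternionNS, (17) p.7] -/
private theorem s6_quatOf_zero : quatOf (0 : E3) = 0 := by
  ext <;> simp [quatOf]

/-- The quaternion units have norm one. [cite: Chishtie2025QuaternionNS, (18) p.7] -/
private theorem s6_norm_units : ‖qi‖ = 1 ∧ ‖qj‖ = 1 ∧ ‖qk‖ = 1 := by
  have h : ∀ q : ℍ, Quaternion.normSq q = 1 → ‖q‖ = 1 := fun q hq => by
    have h2 : ‖q‖ ^ 2 = 1 ^ 2 := by rw [sq, ← Quaternion.normSq_eq_norm_mul_self, hq, one_pow]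
    exact (pow_left_inj₀ (norm_nonneg _) zero_le_one two_ne_zero).mp h2
  refine ⟨h _ ?_, h _ ?_, h _ ?_⟩ <;> simp [qi, qj, qk, Quaternion.normSq_def']

/-- Pointwise `‖∇_{Q̄} Q (x)‖² ≤ 3 |∇Q|²(x)`. [cite: Chishtie2025QuaternionNS, (70) p.12, (89) p.14] -/
private theorem s6_norm_nablaQbar_sq_le (u : E3 → E3) (x : E3) :
    ‖nablaQbar (Qf u) x‖ ^ 2 ≤ 3 * gradNormSq (Qf u) x := by
  obtain ⟨hqi, hqj, hqk⟩ := s6_norm_units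
  set a := ‖pd 0 (Qf u) x‖ with ha
  set b := ‖pd 1 (Qf u) x‖ with hb
  set c := ‖pd 2 (Qf u) x‖ with hc
  have htri : ‖nablaQbar (Qf u) x‖ ≤ a + b + c := by
    unfold nablaQbar
    calc ‖qi * pd 0 (Qf u) x - qj * pd 1 (Qf u) x - qk * pd 2 (Qf u) x‖
        ≤ ‖qi * pd 0 (Qf u) x - qj * pd 1 (Qf u) x‖ + ‖qk * pd 2 (Qf u) x‖ := norm_sub_le _ _
      _ ≤ (‖qi * pd 0 (Qf u) x‖ + ‖qj * pd 1 (Qf u) x‖) + ‖qk * pd 2 (Qf u) x‖ := by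
          gcongr; exact norm_sub_le _ _
      _ = a + b + c := by rw [norm_mul, norm_mul, norm_mul, hqi, hqj, hqk, ha, hb, hc]; ring
  have hsum : gradNormSq (Qf u) x = a ^ 2 + b ^ 2 + c ^ 2 := by
    simp [gradNormSq, Fin.sum_univ_three, ha, hb, hc]
  have hsq := mul_self_le_mul_self (norm_nonneg _) htri
  rw [hsum]
  nlinarith [hsq, sq_nonneg (a - b), sq_nonneg (b - c), sq_nonneg (a - c)]

/-- `∇_Q Q = quatOf (curl u)` pointwise for a divergence-free smooth field (real part `= −div u`).
[cite: Chishtie2025QuaternionNS, (69) p.12, (77) p.13] -/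
private theorem s6_nablaQ_eq_quatOf_curl (hu : ContDiff ℝ ∞ u) (hdiv : NSWave0.IsDivFree u) (x : E3) :
    nablaQ (Qf u) x = quatOf (curl u x) := by
  have hdx : HasFDerivAt u (fderiv ℝ u x) x := ((hu.differentiable (by simp)) x).hasFDerivAt
  have hpd : ∀ j, pd j (Qf u) x = quatOf (fderiv ℝ u x (e j)) := fun j => pd_Qf hdx j
  have hdiv' : fderiv ℝ u x (e 0) 0 + fderiv ℝ u x (e 1) 1 + fderiv ℝ u x (e 2) 2 = 0 := by
    have h := hdiv x
    change VectorCalculus.divergence u x = 0 at h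
    rw [divergence_eq_sum_inner_fderiv (EuclideanSpace.basisFun (Fin 3) ℝ), Fin.sum_univ_three] at h
    simpa [e, EuclideanSpace.basisFun_apply, EuclideanSpace.inner_single_left] using h
  rw [nablaQ, hpd 0, hpd 1, hpd 2]
  simp only [e] at hdiv'
  ext
  · simp [quatOf, qi, qj, qk, e, curl]
    linear_combination -hdiv'
  · simp [quatOf, qi, qj, qk, e, curl]; ring
  · simp [quatOf, qi, qj, qk, e, curl]; ring
  · simp [quatOf, qi, qj, qk, e, curl]; ring

/-- `|∇Q|²(x) = |Du(x)|²_F` (`‖quatOf v‖ = ‖v‖`, basis independence of the Frobenius norm).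
[cite: Chishtie2025QuaternionNS, (72) p.12] -/
private theorem s6_gradNormSq_eq_frob (hu : ContDiff ℝ ∞ u) (x : E3) :
    gradNormSq (Qf u) x = frobeniusNormSq (fderiv ℝ u x) := by
  have hdx : HasFDerivAt u (fderiv ℝ u x) x := ((hu.differentiable (by simp)) x).hasFDerivAt
  have hpd : ∀ j, pd j (Qf u) x = quatOf (fderiv ℝ u x (e j)) := fun j => pd_Qf hdx j
  rw [frobeniusNormSq_eq_sum (EuclideanSpace.basisFun (Fin 3) ℝ), gradNormSq]
  refine Finset.sum_congr rfl fun j _ => ?_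
  rw [hpd j, norm_quatOf, EuclideanSpace.basisFun_apply, e]

/-- `x ↦ |Du(x)|²_F` is continuous with compact support, hence integrable.
[cite: Chishtie2025QuaternionNS, (85) p.14] -/
private theorem s6_integrable_frob (hu : ContDiff ℝ ∞ u) (hc : HasCompactSupport u) :
    Integrable fun x => frobeniusNormSq (fderiv ℝ u x) := by
  have hcont : Continuous fun x => frobeniusNormSq (fderiv ℝ u x) := by
    unfold frobeniusNormSq
    refine continuous_finsetSum _ fun i _ => ?_
    exact (((hu.continuous_fderiv (by norm_num)).clm_apply continuous_const).norm).pow 2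
  have hsupp : HasCompactSupport fun x => frobeniusNormSq (fderiv ℝ u x) :=
    (hc.fderiv (𝕜 := ℝ)).comp_left (g := frobeniusNormSq) (by simp [frobeniusNormSq])
  exact hcont.integrable_of_hasCompactSupport hsupp

/-- `x ↦ ‖curl u (x)‖²` is integrable for smooth compactly supported `u`.
[cite: Chishtie2025QuaternionNS, (85) p.14] -/
private theorem s6_integrable_curl_sq (hu : ContDiff ℝ ∞ u) (hc : HasCompactSupport u) :
    Integrable fun x => ‖curl u x‖ ^ 2 := by
  have hu1 : ContDiff ℝ 1 u := hu.of_le (by norm_num)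
  have hcont : Continuous (curl u) := by
    rw [curl_eq_curlCLM_comp]; exact curlCLM.continuous.comp (hu1.continuous_fderiv one_ne_zero)
  have hsupp : HasCompactSupport (curl u) := by
    rw [curl_eq_curlCLM_comp]
    exact (hc.fderiv (𝕜 := ℝ)).comp_left (g := (curlCLM : (E3 →L[ℝ] E3) → E3)) (map_zero curlCLM)
  have hsupp2 : HasCompactSupport fun x => ‖curl u x‖ ^ 2 :=
    hsupp.comp_left (g := fun v : E3 => ‖v‖ ^ 2) (by simp)
  exact (hcont.norm.pow 2).integrable_of_hasCompactSupport hsupp2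

/-- **Step 6 — the «conjugate gradient bound» (89) p.14 — is a THEOREM**, with `C = 3`:
`‖∇_{Q̄} Q‖²_{L²} ≤ 3 ‖∇_Q Q‖^{1/2}_{L²} ‖Q‖^{3/2}_{H¹}` for every smooth compactly supported divergence-free
field (route in the section docstring; the printed derivation (90)–(96) is not used).
[cite: Chishtie2025QuaternionNS, (89)–(96) p.14] -/
theorem step6_ConjugateBound89_holds : Step6_ConjugateBound89 := by
  refine ⟨3, by norm_num, fun u hu hc hdiv => ?_⟩
  set L := l2sq (Qf u) with hL
  set G := ∫ x, gradNormSq (Qf u) x with hG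
  set K := l2sq (nablaQ (Qf u)) with hK
  have hGfrob : (fun x => gradNormSq (Qf u) x) = fun x => frobeniusNormSq (fderiv ℝ u x) :=
    funext (s6_gradNormSq_eq_frob hu)
  have hGint : Integrable fun x => gradNormSq (Qf u) x := by
    rw [hGfrob]; exact s6_integrable_frob hu hc
  have hG0 : 0 ≤ G := integral_nonneg fun x => by simp only [gradNormSq]; positivity
  have hL0 : 0 ≤ L := integral_nonneg fun x => by positivity
  -- (i) `‖∇_{Q̄}Q‖²_{L²} ≤ 3 G`
  have h1 : l2sq (nablaQbar (Qf u)) ≤ 3 * G := by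
    have hmono := integral_mono_of_nonneg (μ := (volume : Measure E3))
      (f := fun x => ‖nablaQbar (Qf u) x‖ ^ 2) (g := fun x => 3 * gradNormSq (Qf u) x)
      (Eventually.of_forall fun x => by positivity) (hGint.const_mul 3)
      (Eventually.of_forall fun x => s6_norm_nablaQbar_sq_le u x)
    rw [integral_const_mul] at hmono
    exact hmono
  -- (ii) `G ≤ K = ∫ ‖curl u‖²` (whole-space `div`–`curl` estimate)
  have hK_eq : K = ∫ x, ‖curl u x‖ ^ 2 :=
    integral_congr_ae (Eventually.of_forall fun x => by
      simp only [s6_nablaQ_eq_quatOf_curl hu hdiv x, norm_quatOf])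
  have h2 : G ≤ K := by
    have hu2 : ContDiff ℝ 2 u := hu.of_le (by norm_cast)
    have hdivV : VectorCalculus.IsDivFree u := fun x => hdiv x
    have hmem : MemLp u 2 (volume : Measure E3) := hu.continuous.memLp_of_hasCompactSupport hc
    have hL2 : ∫⁻ x, ‖u x‖ₑ ^ 2 < ⊤ := by
      have h := hmem.eLpNorm_lt_top
      rw [eLpNorm_eq_lintegral_rpow_enorm_toReal (by norm_num) (by norm_num)] at h
      have h2' : (2 : ℝ≥0∞).toReal = 2 := by norm_num
      rw [h2'] at h
      have h3 := ENNReal.rpow_lt_top_of_nonneg (by norm_num : (0 : ℝ) ≤ 2) (lt_top_iff_ne_top.1 h)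
      rw [← ENNReal.rpow_mul] at h3
      norm_num at h3
      simpa using h3
    have hle := lintegral_frobeniusNormSq_fderiv_le_lintegral_sq_norm_curl hu2 hdivV hL2
    have hlhs : ∫⁻ x, ENNReal.ofReal (frobeniusNormSq (fderiv ℝ u x)) = ENNReal.ofReal G := by
      rw [hG, hGfrob, ofReal_integral_eq_lintegral_ofReal (s6_integrable_frob hu hc)
        (Eventually.of_forall fun x => frobeniusNormSq_nonneg _)]
    have hrhs : ∫⁻ x, ‖curl u x‖ₑ ^ 2 = ENNReal.ofReal (∫ x, ‖curl u x‖ ^ 2) := by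
      rw [ofReal_integral_eq_lintegral_ofReal (s6_integrable_curl_sq hu hc)
        (Eventually.of_forall fun x => by positivity)]
      refine lintegral_congr fun x => ?_
      rw [← ofReal_norm, ← ENNReal.ofReal_pow (norm_nonneg _)]
    rw [hlhs, hrhs] at hle
    rw [hK_eq]
    exact (ENNReal.ofReal_le_ofReal_iff (integral_nonneg fun x => by positivity)).mp hle
  -- (iii) `3 G = 3 G^{1/4} G^{3/4} ≤ 3 K^{1/4} (L + G)^{3/4}`
  have hkey : Real.sqrt (Real.sqrt G) * Real.sqrt G ^ (3 / 2 : ℝ) = G := by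
    have hr : 0 ≤ Real.sqrt G := Real.sqrt_nonneg _
    rw [Real.sqrt_eq_rpow (Real.sqrt G), ← Real.rpow_add_of_nonneg hr (by norm_num) (by norm_num),
      show (1 / 2 + 3 / 2 : ℝ) = 2 by norm_num, Real.rpow_two, Real.sq_sqrt hG0]
  show l2sq (nablaQbar (Qf u)) ≤ 3 * Real.sqrt (Real.sqrt K) * Real.sqrt (L + G) ^ (3 / 2 : ℝ)
  calc l2sq (nablaQbar (Qf u)) ≤ 3 * G := h1
    _ = 3 * (Real.sqrt (Real.sqrt G) * Real.sqrt G ^ (3 / 2 : ℝ)) := by rw [hkey]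
    _ ≤ 3 * (Real.sqrt (Real.sqrt K) * Real.sqrt (L + G) ^ (3 / 2 : ℝ)) := by
        have hGK : G ≤ K := h2
        have hGLG : G ≤ L + G := by linarith
        gcongr
    _ = 3 * Real.sqrt (Real.sqrt K) * Real.sqrt (L + G) ^ (3 / 2 : ℝ) := by ring

/-- `Step6_ConjugateBound89` — `_holds` alias of `step6_ConjugateBound89_holds` above under the fact's exact name (appended
2026-08-28, D-0026 bookkeeping: the proof term is the existing theorem of this file; no statement,
definition or attribute is edited; no new named fact; the ledger's debt table listed the fact
unproved). [cite: Chishtie2025QuaternionNS, (89)–(96) p.14] -/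
theorem _root_.Literature.Claims.NS.Chishtie2025.Step6_ConjugateBound89_holds :
    Step6_ConjugateBound89 :=
  _root_.Literature.Claims.NS.Chishtie2025.step6_ConjugateBound89_holds

end Step6Certificate

end Literature.Claims.NS.Chishtie2025
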